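/-
Origin: expansion seat `prover-pub-hodgecm-mc-binder-1-g19-0`, handover #R130 2026-08-21T03:28:35Z md5 954731491fe8 (492 l.; NEW additive MODEL leaf, ns HodgeCM.Model.ThetaAdelicSide (+ ….ThetaDistDatum); imports binder-1 #R129 Model/AdelicThetaDistributionMultPinG (this run, kit r1 f3c66fc13ceb) ONLY; DROP-ALONE (nothing imports it); 0 defs, 0 records, 0 `def … : Prop`, nothing cited, eight theorems = the `adelicThetaSpanSat (satG hV K)`-INPUT form of binder-1's `hfam` clause-2 block theorems (binder-2-g20 ASK STATUS l.15068), pin-generic over ANY `S : ThetaAdelicSide V c` reading `hP : (S.P k).ω = lineRepOf V c.D hGR hGR₀ hGR₁ hGR₂ hGR₃ χ₀ χ₁ χ₂ χ₃ k`, all four slots: § 1 `ThetaDistDatum.clsU_mem_iSup_block_of_mem_adelicThetaSpanSat_of_lineRepOf_k (hP) (hωA : D.ωA = lineOmega_k … χ_k) (hΦ : D.Φarch ≠ 0) (hGfin) (hLF) (hd) (hCR) (K : Subgroup V.adelicFin) (hF : F ∈ adelicThetaSpanSat (S.P k) S.ιinf (stabilizer U21 x₀).subtype (weightOf x₀) (satG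 hV K) 𝓕) : ∃ hF' : F ∈ S.holSatU hV k 𝓕, S.clsU … ⟨F,hF'⟩ ∈ ⨆_{χ, charInv χ ∈ 𝓕} ⨆ ψ : (D.coinvRep χ).asModule →ₗ Tower, range ψ` (= #R124 §1 `…_of_multOne` with `har` := #R128 `ω_regime_archToAdelic_of_lineRepOf_k hP`, (J4-mult1) discharged by #R128 `rank_admFamilies_le_one_of_lineRepOf_k hωA` / carch #CA64); § 2 `clsU_mem_iSup_block_of_mem_adelicThetaSpanSat_pin_kG (h𝓕) (hGfin) (hLF) K hF` at `D := pinDatum_kG …` (#R129), `hωA := rfl`, hd/hCR by carch #CA62/#CA67 `hd/hCR_lineOmega_kG`, `Φarch ≠ 0` by PKG `blockFamilyOfAt_degOnePDual_binvPi_one_ne_zero` — hypotheses LEFT: pin data, `hGfin`/`hLF`, `hι`, `hP`, `h𝓕`; the landed `holSat` forms are the case `K := Γ.K, hF := hF.1`; default-split pin (`archSideOf …`, `χ_k := eta_k …`, `hι hP := rfl`) and R2 pin of record (`archSideOfT' …`, `χ_k := etaT_k …`, `hι hP := rfl`, sinst-1 #1263) are one-line instances; NAMES for audit: HodgeCM.Model.ThetaAdelicSide.ThetaDistDatum.clsU_mem_iSup_block_of_mem_adelicThetaSpanSat_of_lineRepOf_one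 · HodgeCM.Model.ThetaAdelicSide.clsU_mem_iSup_block_of_mem_adelicThetaSpanSat_pinZeroG · HodgeCM.Model.ThetaAdelicSide.clsU_mem_iSup_block_of_mem_adelicThetaSpanSat_pinOneG; NAME LIST: HodgeCM.Model.ThetaAdelicSide.ThetaDistDatum.clsU_mem_iSup_block_of_mem_adelicThetaSpanSat_of_lineRepOf_one · HodgeCM.Model.ThetaAdelicSide.clsU_mem_iSup_block_of_mem_adelicThetaSpanSat_pinZeroG · HodgeCM.Model.ThetaAdelicSide.clsU_mem_iSup_block_of_mem_adelicThetaSpanSat_pinOneG; all decls: HodgeCM.Model.ThetaAdelicSide.ThetaDistDatum.clsU_mem_iSup_block_of_mem_adelicThetaSpanSat_of_lineRepOf_zero · HodgeCM.Model.ThetaAdelicSide.ThetaDistDatum.clsU_mem_iSup_block_of_mem_adelicThetaSpanSat_of_lineRepOf_one · HodgeCM.Model.ThetaAdelicSide.ThetaDistDatum.clsU_mem_iSup_block_of_mem_adelicThetaSpanSat_of_lineRepOf_two · HodgeCM.Model.ThetaAdelicSide.ThetaDistDatum.clsU_mem_iSup_block_of_mem_adelicThetaSpanSat_of_lineRepOf_three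 · HodgeCM.Model.ThetaAdelicSide.clsU_mem_iSup_block_of_mem_adelicThetaSpanSat_pinZeroG · HodgeCM.Model.ThetaAdelicSide.clsU_mem_iSup_block_of_mem_adelicThetaSpanSat_pinOneG · HodgeCM.Model.ThetaAdelicSide.clsU_mem_iSup_block_of_mem_adelicThetaSpanSat_pinTwoG · HodgeCM.Model.ThetaAdelicSide.clsU_mem_iSup_block_of_mem_adelicThetaSpanSat_pinThreeG) (`HOME/mc/pub-hodgecm-mc-binder-1-g19/stage71/HodgeCM/Model/AdelicThetaDistributionMultSpanG.lean`, md5 954731491fe8, 492 lines);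
landed by the gen-30 packager (p-g30) in gate run 71 as `HodgeCM/Model/AdelicThetaDistributionMultSpanG.lean` (verbatim).
-/
/-
Copyright (c) 2026 the pub-hodgecm formalisation cell (harness21).  New file, not vendored.
Origin: session prover-pub-hodgecm-mc-binder-1-g19-0 (unit pub-hodgecm-mc-binder-1-g19, BINDER PROVER gen 19; the `adelicThetaSpanSat`-INPUT form of
binder-1's `hfam` clause-2 block theorems, pin-generically, all four slots — asked by binder-2-g20 STATUS l.15068 «please export the
`adelicThetaSpanSat (satG hV K)`-input variants … next to the `holSat` ones … and the same over sinst-1's `…OfT'` at the R2 pin»), 2026-08-21.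
Intended final place: `HodgeCM/Model/AdelicThetaDistributionMultSpanG.lean` (NEW additive model-layer leaf; imports binder-1's
`HodgeCM.Model.AdelicThetaDistributionMultPinG` (#R129) only; nothing imports it; drop alone).
-/
import Summits.HodgeConjecture.HodgeCM.Model.AdelicThetaDistributionMultPinG_2

set_option autoImplicit false

/-!
# `hfam` clause 2 for saturated ADELIC THETA FORMS (input `F ∈ adelicThetaSpanSat … (satG hV K) 𝓕`), pin-generically, all four slots

The landed block theorems of binder-1 (#R124 §2, #R126, #R128 `…_of_lineRepOf_k`, #R125r2/#R127/#R129 `…_pin_k[G]`) take a saturated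
HOL-GERM theta form `F ∈ S.holSat hV k Γ 𝓕` (sinst-1 #1242).  The (J2) unfolding used by the junction child (binder-2-g20 STATUS l.15068:
sinst-1 #1238 `exists_fixed_adelic_lift_of_mem_thetaOf`) delivers the form one step earlier, as
`F ∈ adelicThetaSpanSat (S.P k) S.ιinf (stabilizer U21 x₀).subtype (weightOf x₀) (satG hV K) 𝓕` — the input of #R124 §1
`ThetaDistDatum.clsU_mem_iSup_block_of_mem_adelicThetaSpanSat_of_multOne`.  This file exports that input form at the two generic levels of
#R128/#R129, so that no consumer re-derives it:
* § 1 (generic datum) **`ThetaDistDatum.clsU_mem_iSup_block_of_mem_adelicThetaSpanSat_of_lineRepOf_{zero,one,two,three}`**: for ANY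
  `S : ThetaAdelicSide V c` with `hP : (S.P k).ω = lineRepOf V c.D hGR hGR₀ hGR₁ hGR₂ hGR₃ χ₀ χ₁ χ₂ χ₃ k` and ANY `D : S.ThetaDistDatum hV k` with
  `hωA : D.ωA = lineOmega_k … χ_k`, `hΦ : D.Φarch ≠ 0`, the side's `hGfin`/`hLF`, the germ facts `hd`/`hCR`, `hι`, and weight functions
  `𝓕 ⊆ {charInv χ}`: every `F ∈ adelicThetaSpanSat (S.P k) S.ιinf _ _ (satG hV K) 𝓕` lies in `S.holSatU hV k 𝓕` and its tower class lies in
  `⨆_{χ, charInv χ ∈ 𝓕} ⨆_{ψ : (D.coinvRep χ).asModule →ₗ Tower} range ψ` — #R124 §1 with `har` := #R128 `ω_regime_archToAdelic_of_lineRepOf_k hP`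
  and the (J4-mult1) input DISCHARGED by #R128 `rank_admFamilies_le_one_of_lineRepOf_k hωA` (carch #CA64); the landed `…holSat_of_lineRepOf_k`
  is the case `K := Γ.K`, `hF := hF.1`;
* § 2 (the pins) **`clsU_mem_iSup_block_of_mem_adelicThetaSpanSat_pin{Zero,One,Two,Three}G`**: § 1 at `D := pinDatum_kG …` (#R129) with
  `hωA := rfl`, `hd`/`hCR` by carch #CA62/#CA67 `hd/hCR_lineOmega_kG`, `Φarch ≠ 0` by PKG `ArchSideTerm.blockFamilyOfAt_degOnePDual_binvPi_one_ne_zero`;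
  hypotheses LEFT: the pin data (`hemb eR eS hχ a hω hdefI`, `hχc`, `h₁W` on slots 0–2), the side's `hGfin`/`hLF`, `hι`, `hP`, `h𝓕` — nothing
  archimedean beyond the pin identities, nothing cited.  At the default-split pin `S := archSideOf … η …` (`χ_k := eta_k V c.D η`,
  `hι hP := rfl`) and at the R2 pin of record `S := archSideOfT' … η ν ν' …` (`χ_k := etaT_k …`, `hι hP := rfl`; sinst-1 #1263
  `thetaDistDatum_kOfT'`) these are the slot theorems a consumer instantiates by name.
KERNEL only: eight theorems, 0 defs, 0 records, 0 `def … : Prop`, nothing cited; `#print axioms` ⊆ {propext, Classical.choice, Quot.sound}.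
-/

noncomputable section

open NumberField hiding relNormOneIdeles relNormOneRat probHaarRelNormOneQuot
open _root_.NumberField.InfinitePlace _root_.NumberField.mixedEmbedding MeasureTheory MulAction IsDedekindDomain
open scoped Matrix TensorProduct Classical SchwartzMap
open Literature.Geometry.ComplexHyperbolic.BallModel (U21 x₀ stabilizerEquivK21)
open Literature.NumberTheory.Automorphic.U21 (K21 matA sclD)
open Literature.NumberTheory.Automorphic Literature.NumberTheory.Automorphic.UnitaryGroup Literature.NumberTheory.Weil1964
open Literature.NumberTheory.GelbartRogawski1991 Literature.NumberTheory.GelbartRogawski1991.UnitaryDualPair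
open Literature.AlgebraicGeometry.HodgeTheory Literature.AlgebraicGeometry.ShimuraVarieties Literature.AlgebraicGeometry.ShimuraVarieties.BallForms
open Literature.NumberTheory.Automorphic.PicardCM
open Literature.NumberTheory.Transcendental (Arapura2012_Cor_15_4_6)
open Literature.Analysis.SegalBargmann
open HodgeCM.Adelic HodgeCM.PerL34 HodgeCM.Model.HypCensus HodgeCM.Model.ArchSideTerm HodgeCM.Model.ThetaDistFin HodgeCM.Model.TowerCarrier
open HodgeCM.Model.SupplyInstance HodgeCM.Model.SupplyResidual HodgeCM.Model.ThetaSpace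
open HodgeCM.Model.SupplyResidual.WeilPairData (charInv)

namespace HodgeCM.Model
namespace ThetaAdelicSide

variable (hHD : exists_isReal_hodgeModel) (hI : hodgePQ_independent_of_hodgeModel)
  (h₁ : BallQuotientUniformised) (h₃ : CMAbelianVarietyRealised) (hA : Arapura2012_Cor_15_4_6)
variable {L : CMField} {ι₁ : L →+* ℂ} (V : HermSpace3 L ι₁) (c : SeesawCtx L) (S : ThetaAdelicSide V c)
  (hGR : (cmSplittingDatum (L : Type) finProdFinEquiv (frameD V) (frameD_real V) (frameD_ne V) (dW c.D) (dW_real c.D)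
    (dW_ne c.D)).CompatibleSplitting)
  (hGR₀ : (cmSplittingDatum (L : Type) (e₁) (frameD V) (frameD_real V) (frameD_ne V) (lineVec (L : Type) (dW c.D 0))
    (fun _ => dW_real c.D 0) (fun _ => dW_ne c.D 0)).CompatibleSplitting)
  (hGR₁ : (cmSplittingDatum (L : Type) (e₁) (frameD V) (frameD_real V) (frameD_ne V) (lineVec (L : Type) (dW c.D 1))
    (fun _ => dW_real c.D 1) (fun _ => dW_ne c.D 1)).CompatibleSplitting)
  (hGR₂ : (cmSplittingDatum (L : Type) (e₁) (frameD V) (frameD_real V) (frameD_ne V) (lineVec (L : Type) (dW' c.D 0))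
    (fun _ => dW'_real c.D 0) (fun _ => dW'_ne c.D 0)).CompatibleSplitting)
  (hGR₃ : (cmSplittingDatum (L : Type) (e₁) (frameD V) (frameD_real V) (frameD_ne V) (lineVec (L : Type) (dW' c.D 1))
    (fun _ => dW'_real c.D 1) (fun _ => dW'_ne c.D 1)).CompatibleSplitting)
  (χ₀ χ₁ χ₂ χ₃ : CMAdelic (L : Type) (frameD V) × CMAdelicOne (L : Type) →* ℂˣ)
  (hι : S.ιinf = archInfOf V)
  (h₁W : (∀ j, 0 < (ι₁ (dW c.D j)).re) ∨ ∀ j, (ι₁ (dW c.D j)).re < 0)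
  (hV : IsAnisotropic L V.Hm)
  (hemb : (InfinitePlace.mk ι₁).embedding = ι₁)

/-! ### § 1. Generic datum: the `adelicThetaSpanSat`-input block theorem for every datum reading `lineRepOf`, all four slots -/

namespace ThetaDistDatum

variable {V c S hV}
variable
  {𝓕 : Set C(↥(relNormOneIdeles (↥(maximalRealSubfield L)) L) ⧸ relNormOneRat (↥(maximalRealSubfield L)) L, ℂ)}
  (h𝓕 : ∀ f ∈ 𝓕, ∃ χ : PontryaginDual (↥(relNormOneIdeles (↥(maximalRealSubfield L)) L) ⧸ relNormOneRat (↥(maximalRealSubfield L)) L),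
    f = charInv χ)

section Zero

variable (D : S.ThetaDistDatum hV 0)
  (hP : (S.P 0).ω = lineRepOf V c.D hGR hGR₀ hGR₁ hGR₂ hGR₃ χ₀ χ₁ χ₂ χ₃ 0)
  (hωA : D.ωA = lineOmega_zero V c.D hGR hGR₀ hGR₁ χ₀)

include hP hωA h𝓕 in
/-- **`hfam` clause 2 for EVERY saturated adelic theta form of slot 0** (input `F ∈ adelicThetaSpanSat … (satG hV K) 𝓕`), for every side
reading `lineRepOf` and every datum with `ωA = lineOmega_zero …` and `Φarch ≠ 0` — no multiplicity / archimedean-operator hypothesis: `F ∈ holSatU`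
and its tower class lies in `⨆_{χ, charInv χ ∈ 𝓕} block(Ω_0(χ))`, `Ω_0(χ) = (D.coinvRep χ).asModule` (#R124 §1 + #R128). -/
theorem clsU_mem_iSup_block_of_mem_adelicThetaSpanSat_of_lineRepOf_zero (hΦ : D.Φarch ≠ 0)
    (hGfin : ∀ K : Subgroup ↥V.adelicFin, satG hV K ≤ S.Gfin) (hLF : (S.P 0).IsLFAction)
    (hd : ∀ (T : 𝓢((Fin 3 → mixedSpace (↥(maximalRealSubfield L))), ℂ) →L[ℂ] ℂ) (ℓ : Module.Dual ℂ (Fin 2 → ℂ)),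
      DifferentiableAt ℝ (fun b => T (D.ωA (BallForms.expP b) (D.Φarch ℓ))) 0)
    (hCR : ∀ (T : 𝓢((Fin 3 → mixedSpace (↥(maximalRealSubfield L))), ℂ) →L[ℂ] ℂ) (ℓ : Module.Dual ℂ (Fin 2 → ℂ)) (v : Fin 2 → ℂ),
      fderiv ℝ (fun b => T (D.ωA (BallForms.expP b) (D.Φarch ℓ))) 0 (Complex.I • v) =
        Complex.I • fderiv ℝ (fun b => T (D.ωA (BallForms.expP b) (D.Φarch ℓ))) 0 v)
    (K : Subgroup ↥V.adelicFin)
    {F : (V.latticeModel printFact_unitaryCompact_holds).G → (Fin 2 → ℂ)}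
    (hF : F ∈ adelicThetaSpanSat (S.P 0) S.ιinf (stabilizer U21 x₀).subtype (BallForms.isPullbackCocycle_cotangentCocycle.weightOf x₀)
      (satG hV K) 𝓕) :
    ∃ hF' : F ∈ S.holSatU hV 0 𝓕,
      S.clsU hHD hI h₁ h₃ hA 𝓕 hι hV 0 ⟨F, hF'⟩ ∈
        ⨆ (χ : PontryaginDual (↥(relNormOneIdeles (↥(maximalRealSubfield L)) L) ⧸ relNormOneRat (↥(maximalRealSubfield L)) L))
          (_ : charInv χ ∈ 𝓕),
          ⨆ ψ : (D.coinvRep χ).asModule →ₗ[MonoidAlgebra ℂ ↥V.adelicFin] Tower hHD hI (ballQuotientUniformisedDatum_of h₁) h₃ hA V,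
            (LinearMap.range ψ).restrictScalars ℂ :=
  D.clsU_mem_iSup_block_of_mem_adelicThetaSpanSat_of_multOne hHD hI h₁ h₃ hA (archOpZeroG V c hGR hGR₀ hGR₁ χ₀)
    (fun aa _ => ω_regime_archToAdelic_of_lineRepOf_zero V c hGR hGR₀ hGR₁ hGR₂ hGR₃ χ₀ χ₁ χ₂ χ₃ hV S hP aa)
    (D.multOne_of_rank_le_one (archOpZeroG V c hGR hGR₀ hGR₁ χ₀)
      (fun aa _ => ω_regime_archToAdelic_of_lineRepOf_zero V c hGR hGR₀ hGR₁ hGR₂ hGR₃ χ₀ χ₁ χ₂ χ₃ hV S hP aa) hΦ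
      (D.rank_admFamilies_le_one_of_lineRepOf_zero hGR hGR₀ hGR₁ hGR₂ hGR₃ χ₀ χ₁ χ₂ χ₃ hωA))
    hGfin hLF hd hCR h𝓕 hι K hF

end Zero

section One

variable (D : S.ThetaDistDatum hV 1)
  (hP : (S.P 1).ω = lineRepOf V c.D hGR hGR₀ hGR₁ hGR₂ hGR₃ χ₀ χ₁ χ₂ χ₃ 1)
  (hωA : D.ωA = lineOmega_one V c.D hGR hGR₀ hGR₁ χ₁)

include hP hωA h𝓕 in
/-- **`hfam` clause 2 for EVERY saturated adelic theta form of slot 1** (input `F ∈ adelicThetaSpanSat … (satG hV K) 𝓕`), for every side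
reading `lineRepOf` and every datum with `ωA = lineOmega_one …` and `Φarch ≠ 0` — no multiplicity / archimedean-operator hypothesis: `F ∈ holSatU`
and its tower class lies in `⨆_{χ, charInv χ ∈ 𝓕} block(Ω_1(χ))`, `Ω_1(χ) = (D.coinvRep χ).asModule` (#R124 §1 + #R128). -/
theorem clsU_mem_iSup_block_of_mem_adelicThetaSpanSat_of_lineRepOf_one (hΦ : D.Φarch ≠ 0)
    (hGfin : ∀ K : Subgroup ↥V.adelicFin, satG hV K ≤ S.Gfin) (hLF : (S.P 1).IsLFAction)
    (hd : ∀ (T : 𝓢((Fin 3 → mixedSpace (↥(maximalRealSubfield L))), ℂ) →L[ℂ] ℂ) (ℓ : Module.Dual ℂ (Fin 2 → ℂ)),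
      DifferentiableAt ℝ (fun b => T (D.ωA (BallForms.expP b) (D.Φarch ℓ))) 0)
    (hCR : ∀ (T : 𝓢((Fin 3 → mixedSpace (↥(maximalRealSubfield L))), ℂ) →L[ℂ] ℂ) (ℓ : Module.Dual ℂ (Fin 2 → ℂ)) (v : Fin 2 → ℂ),
      fderiv ℝ (fun b => T (D.ωA (BallForms.expP b) (D.Φarch ℓ))) 0 (Complex.I • v) =
        Complex.I • fderiv ℝ (fun b => T (D.ωA (BallForms.expP b) (D.Φarch ℓ))) 0 v)
    (K : Subgroup ↥V.adelicFin)
    {F : (V.latticeModel printFact_unitaryCompact_holds).G → (Fin 2 → ℂ)}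
    (hF : F ∈ adelicThetaSpanSat (S.P 1) S.ιinf (stabilizer U21 x₀).subtype (BallForms.isPullbackCocycle_cotangentCocycle.weightOf x₀)
      (satG hV K) 𝓕) :
    ∃ hF' : F ∈ S.holSatU hV 1 𝓕,
      S.clsU hHD hI h₁ h₃ hA 𝓕 hι hV 1 ⟨F, hF'⟩ ∈
        ⨆ (χ : PontryaginDual (↥(relNormOneIdeles (↥(maximalRealSubfield L)) L) ⧸ relNormOneRat (↥(maximalRealSubfield L)) L))
          (_ : charInv χ ∈ 𝓕),
          ⨆ ψ : (D.coinvRep χ).asModule →ₗ[MonoidAlgebra ℂ ↥V.adelicFin] Tower hHD hI (ballQuotientUniformisedDatum_of h₁) h₃ hA V,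
            (LinearMap.range ψ).restrictScalars ℂ :=
  D.clsU_mem_iSup_block_of_mem_adelicThetaSpanSat_of_multOne hHD hI h₁ h₃ hA (archOpOneG V c hGR hGR₀ hGR₁ χ₁)
    (fun aa _ => ω_regime_archToAdelic_of_lineRepOf_one V c hGR hGR₀ hGR₁ hGR₂ hGR₃ χ₀ χ₁ χ₂ χ₃ hV S hP aa)
    (D.multOne_of_rank_le_one (archOpOneG V c hGR hGR₀ hGR₁ χ₁)
      (fun aa _ => ω_regime_archToAdelic_of_lineRepOf_one V c hGR hGR₀ hGR₁ hGR₂ hGR₃ χ₀ χ₁ χ₂ χ₃ hV S hP aa) hΦ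
      (D.rank_admFamilies_le_one_of_lineRepOf_one hGR hGR₀ hGR₁ hGR₂ hGR₃ χ₀ χ₁ χ₂ χ₃ hωA))
    hGfin hLF hd hCR h𝓕 hι K hF

end One

section Two

variable (D : S.ThetaDistDatum hV 2)
  (hP : (S.P 2).ω = lineRepOf V c.D hGR hGR₀ hGR₁ hGR₂ hGR₃ χ₀ χ₁ χ₂ χ₃ 2)
  (hωA : D.ωA = lineOmega_two V c.D hGR hGR₂ hGR₃ χ₂)

include hP hωA h𝓕 in
/-- **`hfam` clause 2 for EVERY saturated adelic theta form of slot 2** (input `F ∈ adelicThetaSpanSat … (satG hV K) 𝓕`), for every side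
reading `lineRepOf` and every datum with `ωA = lineOmega_two …` and `Φarch ≠ 0` — no multiplicity / archimedean-operator hypothesis: `F ∈ holSatU`
and its tower class lies in `⨆_{χ, charInv χ ∈ 𝓕} block(Ω_2(χ))`, `Ω_2(χ) = (D.coinvRep χ).asModule` (#R124 §1 + #R128). -/
theorem clsU_mem_iSup_block_of_mem_adelicThetaSpanSat_of_lineRepOf_two (hΦ : D.Φarch ≠ 0)
    (hGfin : ∀ K : Subgroup ↥V.adelicFin, satG hV K ≤ S.Gfin) (hLF : (S.P 2).IsLFAction)
    (hd : ∀ (T : 𝓢((Fin 3 → mixedSpace (↥(maximalRealSubfield L))), ℂ) →L[ℂ] ℂ) (ℓ : Module.Dual ℂ (Fin 2 → ℂ)),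
      DifferentiableAt ℝ (fun b => T (D.ωA (BallForms.expP b) (D.Φarch ℓ))) 0)
    (hCR : ∀ (T : 𝓢((Fin 3 → mixedSpace (↥(maximalRealSubfield L))), ℂ) →L[ℂ] ℂ) (ℓ : Module.Dual ℂ (Fin 2 → ℂ)) (v : Fin 2 → ℂ),
      fderiv ℝ (fun b => T (D.ωA (BallForms.expP b) (D.Φarch ℓ))) 0 (Complex.I • v) =
        Complex.I • fderiv ℝ (fun b => T (D.ωA (BallForms.expP b) (D.Φarch ℓ))) 0 v)
    (K : Subgroup ↥V.adelicFin)
    {F : (V.latticeModel printFact_unitaryCompact_holds).G → (Fin 2 → ℂ)}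
    (hF : F ∈ adelicThetaSpanSat (S.P 2) S.ιinf (stabilizer U21 x₀).subtype (BallForms.isPullbackCocycle_cotangentCocycle.weightOf x₀)
      (satG hV K) 𝓕) :
    ∃ hF' : F ∈ S.holSatU hV 2 𝓕,
      S.clsU hHD hI h₁ h₃ hA 𝓕 hι hV 2 ⟨F, hF'⟩ ∈
        ⨆ (χ : PontryaginDual (↥(relNormOneIdeles (↥(maximalRealSubfield L)) L) ⧸ relNormOneRat (↥(maximalRealSubfield L)) L))
          (_ : charInv χ ∈ 𝓕),
          ⨆ ψ : (D.coinvRep χ).asModule →ₗ[MonoidAlgebra ℂ ↥V.adelicFin] Tower hHD hI (ballQuotientUniformisedDatum_of h₁) h₃ hA V,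
            (LinearMap.range ψ).restrictScalars ℂ :=
  D.clsU_mem_iSup_block_of_mem_adelicThetaSpanSat_of_multOne hHD hI h₁ h₃ hA (archOpTwoG V c hGR hGR₂ hGR₃ χ₂)
    (fun aa _ => ω_regime_archToAdelic_of_lineRepOf_two V c hGR hGR₀ hGR₁ hGR₂ hGR₃ χ₀ χ₁ χ₂ χ₃ hV S hP aa)
    (D.multOne_of_rank_le_one (archOpTwoG V c hGR hGR₂ hGR₃ χ₂)
      (fun aa _ => ω_regime_archToAdelic_of_lineRepOf_two V c hGR hGR₀ hGR₁ hGR₂ hGR₃ χ₀ χ₁ χ₂ χ₃ hV S hP aa) hΦ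
      (D.rank_admFamilies_le_one_of_lineRepOf_two hGR hGR₀ hGR₁ hGR₂ hGR₃ χ₀ χ₁ χ₂ χ₃ hωA))
    hGfin hLF hd hCR h𝓕 hι K hF

end Two

section Three

variable (D : S.ThetaDistDatum hV 3)
  (hP : (S.P 3).ω = lineRepOf V c.D hGR hGR₀ hGR₁ hGR₂ hGR₃ χ₀ χ₁ χ₂ χ₃ 3)
  (hωA : D.ωA = lineOmega_three V c.D hGR hGR₂ hGR₃ χ₃)

include hP hωA h𝓕 in
/-- **`hfam` clause 2 for EVERY saturated adelic theta form of slot 3** (input `F ∈ adelicThetaSpanSat … (satG hV K) 𝓕`), for every side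
reading `lineRepOf` and every datum with `ωA = lineOmega_three …` and `Φarch ≠ 0` — no multiplicity / archimedean-operator hypothesis: `F ∈ holSatU`
and its tower class lies in `⨆_{χ, charInv χ ∈ 𝓕} block(Ω_3(χ))`, `Ω_3(χ) = (D.coinvRep χ).asModule` (#R124 §1 + #R128). -/
theorem clsU_mem_iSup_block_of_mem_adelicThetaSpanSat_of_lineRepOf_three (hΦ : D.Φarch ≠ 0)
    (hGfin : ∀ K : Subgroup ↥V.adelicFin, satG hV K ≤ S.Gfin) (hLF : (S.P 3).IsLFAction)
    (hd : ∀ (T : 𝓢((Fin 3 → mixedSpace (↥(maximalRealSubfield L))), ℂ) →L[ℂ] ℂ) (ℓ : Module.Dual ℂ (Fin 2 → ℂ)),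
      DifferentiableAt ℝ (fun b => T (D.ωA (BallForms.expP b) (D.Φarch ℓ))) 0)
    (hCR : ∀ (T : 𝓢((Fin 3 → mixedSpace (↥(maximalRealSubfield L))), ℂ) →L[ℂ] ℂ) (ℓ : Module.Dual ℂ (Fin 2 → ℂ)) (v : Fin 2 → ℂ),
      fderiv ℝ (fun b => T (D.ωA (BallForms.expP b) (D.Φarch ℓ))) 0 (Complex.I • v) =
        Complex.I • fderiv ℝ (fun b => T (D.ωA (BallForms.expP b) (D.Φarch ℓ))) 0 v)
    (K : Subgroup ↥V.adelicFin)
    {F : (V.latticeModel printFact_unitaryCompact_holds).G → (Fin 2 → ℂ)}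
    (hF : F ∈ adelicThetaSpanSat (S.P 3) S.ιinf (stabilizer U21 x₀).subtype (BallForms.isPullbackCocycle_cotangentCocycle.weightOf x₀)
      (satG hV K) 𝓕) :
    ∃ hF' : F ∈ S.holSatU hV 3 𝓕,
      S.clsU hHD hI h₁ h₃ hA 𝓕 hι hV 3 ⟨F, hF'⟩ ∈
        ⨆ (χ : PontryaginDual (↥(relNormOneIdeles (↥(maximalRealSubfield L)) L) ⧸ relNormOneRat (↥(maximalRealSubfield L)) L))
          (_ : charInv χ ∈ 𝓕),
          ⨆ ψ : (D.coinvRep χ).asModule →ₗ[MonoidAlgebra ℂ ↥V.adelicFin] Tower hHD hI (ballQuotientUniformisedDatum_of h₁) h₃ hA V,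
            (LinearMap.range ψ).restrictScalars ℂ :=
  D.clsU_mem_iSup_block_of_mem_adelicThetaSpanSat_of_multOne hHD hI h₁ h₃ hA (archOpThreeG V c hGR hGR₂ hGR₃ χ₃)
    (fun aa _ => ω_regime_archToAdelic_of_lineRepOf_three V c hGR hGR₀ hGR₁ hGR₂ hGR₃ χ₀ χ₁ χ₂ χ₃ hV S hP aa)
    (D.multOne_of_rank_le_one (archOpThreeG V c hGR hGR₂ hGR₃ χ₃)
      (fun aa _ => ω_regime_archToAdelic_of_lineRepOf_three V c hGR hGR₀ hGR₁ hGR₂ hGR₃ χ₀ χ₁ χ₂ χ₃ hV S hP aa) hΦ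
      (D.rank_admFamilies_le_one_of_lineRepOf_three hGR hGR₀ hGR₁ hGR₂ hGR₃ χ₀ χ₁ χ₂ χ₃ hωA))
    hGfin hLF hd hCR h𝓕 hι K hF

end Three

end ThetaDistDatum

/-! ### § 2. At the pin, pin-generically: the `adelicThetaSpanSat`-input block theorem for `pinDatum_kG …`, all four slots -/

/-! ### Slot 0 -/

section Zero

variable (hP : (S.P 0).ω = lineRepOf V c.D hGR hGR₀ hGR₁ hGR₂ hGR₃ χ₀ χ₁ χ₂ χ₃ 0)
  (hχc : Continuous fun p => ((χ₀ p : ℂˣ) : ℂ))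
  (eR : PosIdx (cmXW (L : Type) (frameD V) (lineVec (L : Type) (dW c.D 0)) (fun _ => dW_real c.D 0) ι₁ (HypCensus.cmPlace (L : Type) ι₁)) ≃ Unit)
  (eS : NegIdx (cmXW (L : Type) (frameD V) (lineVec (L : Type) (dW c.D 0)) (fun _ => dW_real c.D 0) ι₁ (HypCensus.cmPlace (L : Type) ι₁)) ≃ Empty)
  (hχ : ∀ u : stabilizer U21 x₀,
    ((lineScalar_zero V c.D hGR hGR₀ hGR₁ χ₀ (u : U21) : ℂˣ) : ℂ) *
        ((matA (stabilizerEquivK21.symm u)).det ^ (lineVacExponentsZero V c hGR₀ h₁W eR eS).eP *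
          sclD (stabilizerEquivK21.symm u) ^ (lineVacExponentsZero V c hGR₀ h₁W eR eS).eQ) =
      star (sclD (stabilizerEquivK21.symm u)))
  (a : {v : InfinitePlace ↥(maximalRealSubfield L) // v.IsReal} → ℤ)
  (hω : ∀ b : {v : InfinitePlace ↥(maximalRealSubfield L) // v.IsReal}, b ≠ HypCensus.cmPlace (L : Type) ι₁ →
    ∀ (u : UnitaryGroup.archLocal (L : Type) 3 (Matrix.diagonal (frameD V)) (cmPlaceOver (L : Type) b)) (ℓ : Module.Dual ℂ (Fin 2 → ℂ)),
      cmArchWeilRep (L : Type) e₁ (frameD V) (frameD_real V) (frameD_ne V) (lineVec (L : Type) (dW c.D 0)) (fun _ => dW_real c.D 0)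
          (fun _ => dW_ne c.D 0) hGR₀
          (UnitaryGroup.archSingle (↥(maximalRealSubfield L)) L (IsCMField.complexConj L) 3 (Matrix.diagonal (frameD V))
            (IsCMField.complexConj_ne_one L) (NumberField.complexConj_smul_infinitePlace (L : Type)) (cmPlaceOver (L : Type) b) u, 1)
          (blockFamilyOfAt (L : Type) e₁ (frameD V) (frameD_real V) (frameD_ne V) (lineVec (L : Type) (dW c.D 0)) (fun _ => dW_real c.D 0)
            (fun _ => dW_ne c.D 0) ι₁ (blockPosEquiv V) (blockNegEquiv V) eR eS (degOnePDual Empty) (binvPi 1) ℓ) =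
        (((u : UnitaryGroup.archLocal (L : Type) 3 (Matrix.diagonal (frameD V)) (cmPlaceOver (L : Type) b)) : GL (Fin 3) ℂ) :
            Matrix (Fin 3) (Fin 3) ℂ).det ^ a b •
          blockFamilyOfAt (L : Type) e₁ (frameD V) (frameD_real V) (frameD_ne V) (lineVec (L : Type) (dW c.D 0)) (fun _ => dW_real c.D 0)
            (fun _ => dW_ne c.D 0) ι₁ (blockPosEquiv V) (blockNegEquiv V) eR eS (degOnePDual Empty) (binvPi 1) ℓ)
  (hdefI : ∀ b : {v : InfinitePlace ↥(maximalRealSubfield L) // v.IsReal}, b ≠ HypCensus.cmPlace (L : Type) ι₁ →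
    ∀ u : UnitaryGroup.archLocal (L : Type) 3 (Matrix.diagonal (frameD V)) (cmPlaceOver (L : Type) b),
      ((archScalar_zeroG V c.D hGR hGR₀ hGR₁ χ₀
          (UnitaryGroup.archSingle (↥(maximalRealSubfield L)) L (IsCMField.complexConj L) 3 (Matrix.diagonal (frameD V))
            (IsCMField.complexConj_ne_one L) (NumberField.complexConj_smul_infinitePlace (L : Type)) (cmPlaceOver (L : Type) b) u) : ℂˣ) : ℂ) *
        (((u : UnitaryGroup.archLocal (L : Type) 3 (Matrix.diagonal (frameD V)) (cmPlaceOver (L : Type) b)) : GL (Fin 3) ℂ) :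
            Matrix (Fin 3) (Fin 3) ℂ).det ^ a b = 1)

/-- **`hfam` clause 2 at the pin, slot 0, for saturated ADELIC THETA FORMS, pin-generically — NO archimedean hypothesis beyond the pin
identities**: for weight functions `𝓕 ⊆ {charInv χ}`, EVERY `F ∈ adelicThetaSpanSat (S.P 0) S.ιinf _ _ (satG hV K) 𝓕` lies in `holSatU` and has
its tower class in `⨆_{χ, charInv χ ∈ 𝓕} block(Ω_0(χ))`, `Ω_0(χ) = ((pinDatumZeroG …).coinvRep χ).asModule` (§ 1 at `hωA := rfl`; `hd`/`hCR` by carch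
`hd/hCR_lineOmega_zeroG`, `Φarch ≠ 0` by `blockFamilyOfAt_degOnePDual_binvPi_one_ne_zero`). The landed `…holSat_pinZeroG` is the case `K := Γ.K`, `hF := hF.1`. -/
theorem clsU_mem_iSup_block_of_mem_adelicThetaSpanSat_pinZeroG
    {𝓕 : Set C(↥(relNormOneIdeles (↥(maximalRealSubfield L)) L) ⧸ relNormOneRat (↥(maximalRealSubfield L)) L, ℂ)}
    (h𝓕 : ∀ f ∈ 𝓕, ∃ χ : PontryaginDual (↥(relNormOneIdeles (↥(maximalRealSubfield L)) L) ⧸ relNormOneRat (↥(maximalRealSubfield L)) L),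
      f = charInv χ)
    (hGfin : ∀ K : Subgroup ↥V.adelicFin, ThetaDistDatum.satG hV K ≤ S.Gfin) (hLF : (S.P 0).IsLFAction) (K : Subgroup ↥V.adelicFin)
    {F : (V.latticeModel printFact_unitaryCompact_holds).G → (Fin 2 → ℂ)}
    (hF : F ∈ adelicThetaSpanSat (S.P 0) S.ιinf (stabilizer U21 x₀).subtype (BallForms.isPullbackCocycle_cotangentCocycle.weightOf x₀)
      (ThetaDistDatum.satG hV K) 𝓕) :
    ∃ hF' : F ∈ S.holSatU hV 0 𝓕,
      S.clsU hHD hI h₁ h₃ hA 𝓕 hι hV 0 ⟨F, hF'⟩ ∈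
        ⨆ (χ : PontryaginDual (↥(relNormOneIdeles (↥(maximalRealSubfield L)) L) ⧸ relNormOneRat (↥(maximalRealSubfield L)) L))
          (_ : charInv χ ∈ 𝓕),
          ⨆ ψ : ((pinDatumZeroG V c S hGR hGR₀ hGR₁ hGR₂ hGR₃ χ₀ χ₁ χ₂ χ₃ hι h₁W hV hemb hP hχc eR eS hχ a hω hdefI).coinvRep χ).asModule
              →ₗ[MonoidAlgebra ℂ ↥V.adelicFin] Tower hHD hI (ballQuotientUniformisedDatum_of h₁) h₃ hA V,
            (LinearMap.range ψ).restrictScalars ℂ :=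
  (pinDatumZeroG V c S hGR hGR₀ hGR₁ hGR₂ hGR₃ χ₀ χ₁ χ₂ χ₃ hι h₁W hV hemb hP hχc eR eS hχ a hω hdefI).clsU_mem_iSup_block_of_mem_adelicThetaSpanSat_of_lineRepOf_zero
    hHD hI h₁ h₃ hA hGR hGR₀ hGR₁ hGR₂ hGR₃ χ₀ χ₁ χ₂ χ₃ hι h𝓕 hP rfl
    (fun h => ArchSideTerm.blockFamilyOfAt_degOnePDual_binvPi_one_ne_zero Empty (L : Type) e₁ (frameD V) (frameD_real V) (frameD_ne V)
      (lineVec (L : Type) (dW c.D 0)) (fun _ => dW_real c.D 0) (fun _ => dW_ne c.D 0) ι₁ (blockPosEquiv V) (blockNegEquiv V) eR eS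
      (by change (pinDatumZeroG V c S hGR hGR₀ hGR₁ hGR₂ hGR₃ χ₀ χ₁ χ₂ χ₃ hι h₁W hV hemb hP hχc eR eS hχ a hω hdefI).Φarch _ = 0; rw [h]; rfl))
    hGfin hLF
    (hd_lineOmega_zeroG V c hGR hGR₀ hGR₁ χ₀ h₁W (binvPi 1) eR eS hemb)
    (hCR_lineOmega_zeroG V c hGR hGR₀ hGR₁ χ₀ h₁W (binvPi 1) eR eS hemb) K hF

end Zero

/-! ### Slot 1 -/

section One

variable (hP : (S.P 1).ω = lineRepOf V c.D hGR hGR₀ hGR₁ hGR₂ hGR₃ χ₀ χ₁ χ₂ χ₃ 1)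
  (hχc : Continuous fun p => ((χ₁ p : ℂˣ) : ℂ))
  (eR : PosIdx (cmXW (L : Type) (frameD V) (lineVec (L : Type) (dW c.D 1)) (fun _ => dW_real c.D 1) ι₁ (HypCensus.cmPlace (L : Type) ι₁)) ≃ Unit)
  (eS : NegIdx (cmXW (L : Type) (frameD V) (lineVec (L : Type) (dW c.D 1)) (fun _ => dW_real c.D 1) ι₁ (HypCensus.cmPlace (L : Type) ι₁)) ≃ Empty)
  (hχ : ∀ u : stabilizer U21 x₀,
    ((lineScalar_one V c.D hGR hGR₀ hGR₁ χ₁ (u : U21) : ℂˣ) : ℂ) *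
        ((matA (stabilizerEquivK21.symm u)).det ^ (lineVacExponentsOne V c hGR₁ h₁W eR eS).eP *
          sclD (stabilizerEquivK21.symm u) ^ (lineVacExponentsOne V c hGR₁ h₁W eR eS).eQ) =
      star (sclD (stabilizerEquivK21.symm u)))
  (a : {v : InfinitePlace ↥(maximalRealSubfield L) // v.IsReal} → ℤ)
  (hω : ∀ b : {v : InfinitePlace ↥(maximalRealSubfield L) // v.IsReal}, b ≠ HypCensus.cmPlace (L : Type) ι₁ →
    ∀ (u : UnitaryGroup.archLocal (L : Type) 3 (Matrix.diagonal (frameD V)) (cmPlaceOver (L : Type) b)) (ℓ : Module.Dual ℂ (Fin 2 → ℂ)),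
      cmArchWeilRep (L : Type) e₁ (frameD V) (frameD_real V) (frameD_ne V) (lineVec (L : Type) (dW c.D 1)) (fun _ => dW_real c.D 1)
          (fun _ => dW_ne c.D 1) hGR₁
          (UnitaryGroup.archSingle (↥(maximalRealSubfield L)) L (IsCMField.complexConj L) 3 (Matrix.diagonal (frameD V))
            (IsCMField.complexConj_ne_one L) (NumberField.complexConj_smul_infinitePlace (L : Type)) (cmPlaceOver (L : Type) b) u, 1)
          (blockFamilyOfAt (L : Type) e₁ (frameD V) (frameD_real V) (frameD_ne V) (lineVec (L : Type) (dW c.D 1)) (fun _ => dW_real c.D 1)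
            (fun _ => dW_ne c.D 1) ι₁ (blockPosEquiv V) (blockNegEquiv V) eR eS (degOnePDual Empty) (binvPi 1) ℓ) =
        (((u : UnitaryGroup.archLocal (L : Type) 3 (Matrix.diagonal (frameD V)) (cmPlaceOver (L : Type) b)) : GL (Fin 3) ℂ) :
            Matrix (Fin 3) (Fin 3) ℂ).det ^ a b •
          blockFamilyOfAt (L : Type) e₁ (frameD V) (frameD_real V) (frameD_ne V) (lineVec (L : Type) (dW c.D 1)) (fun _ => dW_real c.D 1)
            (fun _ => dW_ne c.D 1) ι₁ (blockPosEquiv V) (blockNegEquiv V) eR eS (degOnePDual Empty) (binvPi 1) ℓ)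
  (hdefI : ∀ b : {v : InfinitePlace ↥(maximalRealSubfield L) // v.IsReal}, b ≠ HypCensus.cmPlace (L : Type) ι₁ →
    ∀ u : UnitaryGroup.archLocal (L : Type) 3 (Matrix.diagonal (frameD V)) (cmPlaceOver (L : Type) b),
      ((archScalar_oneG V c.D hGR hGR₀ hGR₁ χ₁
          (UnitaryGroup.archSingle (↥(maximalRealSubfield L)) L (IsCMField.complexConj L) 3 (Matrix.diagonal (frameD V))
            (IsCMField.complexConj_ne_one L) (NumberField.complexConj_smul_infinitePlace (L : Type)) (cmPlaceOver (L : Type) b) u) : ℂˣ) : ℂ) *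
        (((u : UnitaryGroup.archLocal (L : Type) 3 (Matrix.diagonal (frameD V)) (cmPlaceOver (L : Type) b)) : GL (Fin 3) ℂ) :
            Matrix (Fin 3) (Fin 3) ℂ).det ^ a b = 1)

/-- **`hfam` clause 2 at the pin, slot 1, for saturated ADELIC THETA FORMS, pin-generically — NO archimedean hypothesis beyond the pin
identities**: for weight functions `𝓕 ⊆ {charInv χ}`, EVERY `F ∈ adelicThetaSpanSat (S.P 1) S.ιinf _ _ (satG hV K) 𝓕` lies in `holSatU` and has
its tower class in `⨆_{χ, charInv χ ∈ 𝓕} block(Ω_1(χ))`, `Ω_1(χ) = ((pinDatumOneG …).coinvRep χ).asModule` (§ 1 at `hωA := rfl`; `hd`/`hCR` by carch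
`hd/hCR_lineOmega_oneG`, `Φarch ≠ 0` by `blockFamilyOfAt_degOnePDual_binvPi_one_ne_zero`). The landed `…holSat_pinOneG` is the case `K := Γ.K`, `hF := hF.1`. -/
theorem clsU_mem_iSup_block_of_mem_adelicThetaSpanSat_pinOneG
    {𝓕 : Set C(↥(relNormOneIdeles (↥(maximalRealSubfield L)) L) ⧸ relNormOneRat (↥(maximalRealSubfield L)) L, ℂ)}
    (h𝓕 : ∀ f ∈ 𝓕, ∃ χ : PontryaginDual (↥(relNormOneIdeles (↥(maximalRealSubfield L)) L) ⧸ relNormOneRat (↥(maximalRealSubfield L)) L),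
      f = charInv χ)
    (hGfin : ∀ K : Subgroup ↥V.adelicFin, ThetaDistDatum.satG hV K ≤ S.Gfin) (hLF : (S.P 1).IsLFAction) (K : Subgroup ↥V.adelicFin)
    {F : (V.latticeModel printFact_unitaryCompact_holds).G → (Fin 2 → ℂ)}
    (hF : F ∈ adelicThetaSpanSat (S.P 1) S.ιinf (stabilizer U21 x₀).subtype (BallForms.isPullbackCocycle_cotangentCocycle.weightOf x₀)
      (ThetaDistDatum.satG hV K) 𝓕) :
    ∃ hF' : F ∈ S.holSatU hV 1 𝓕,
      S.clsU hHD hI h₁ h₃ hA 𝓕 hι hV 1 ⟨F, hF'⟩ ∈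
        ⨆ (χ : PontryaginDual (↥(relNormOneIdeles (↥(maximalRealSubfield L)) L) ⧸ relNormOneRat (↥(maximalRealSubfield L)) L))
          (_ : charInv χ ∈ 𝓕),
          ⨆ ψ : ((pinDatumOneG V c S hGR hGR₀ hGR₁ hGR₂ hGR₃ χ₀ χ₁ χ₂ χ₃ hι h₁W hV hemb hP hχc eR eS hχ a hω hdefI).coinvRep χ).asModule
              →ₗ[MonoidAlgebra ℂ ↥V.adelicFin] Tower hHD hI (ballQuotientUniformisedDatum_of h₁) h₃ hA V,
            (LinearMap.range ψ).restrictScalars ℂ :=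
  (pinDatumOneG V c S hGR hGR₀ hGR₁ hGR₂ hGR₃ χ₀ χ₁ χ₂ χ₃ hι h₁W hV hemb hP hχc eR eS hχ a hω hdefI).clsU_mem_iSup_block_of_mem_adelicThetaSpanSat_of_lineRepOf_one
    hHD hI h₁ h₃ hA hGR hGR₀ hGR₁ hGR₂ hGR₃ χ₀ χ₁ χ₂ χ₃ hι h𝓕 hP rfl
    (fun h => ArchSideTerm.blockFamilyOfAt_degOnePDual_binvPi_one_ne_zero Empty (L : Type) e₁ (frameD V) (frameD_real V) (frameD_ne V)
      (lineVec (L : Type) (dW c.D 1)) (fun _ => dW_real c.D 1) (fun _ => dW_ne c.D 1) ι₁ (blockPosEquiv V) (blockNegEquiv V) eR eS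
      (by change (pinDatumOneG V c S hGR hGR₀ hGR₁ hGR₂ hGR₃ χ₀ χ₁ χ₂ χ₃ hι h₁W hV hemb hP hχc eR eS hχ a hω hdefI).Φarch _ = 0; rw [h]; rfl))
    hGfin hLF
    (hd_lineOmega_oneG V c hGR hGR₀ hGR₁ χ₁ h₁W (binvPi 1) eR eS hemb)
    (hCR_lineOmega_oneG V c hGR hGR₀ hGR₁ χ₁ h₁W (binvPi 1) eR eS hemb) K hF

end One

/-! ### Slot 2 -/

section Two


-- port_pkg: scope closed for this part
end Two
end ThetaAdelicSide
end HodgeCM.Model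
end
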